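import Summits.MatrixMultiplication.MatrixMultiplication.Theorems.EdgePencilTerminalSlope
import Literature.Computability.AlgebraicComplexity.FlatteningBound
import HarnessLib

/-!
# Lower readings of the sixth-edge pencil: the one-sided dual reading of `σ(K₄)`, typed

Support kernel for `stmt-MatrixMultiplication-26697` (`TetraExcessZero : ω(K₄) ≤ ω(2,1,2)`) of route
`TetrahedronCarving` (lineage `decomp-mm-lens-6`, generation 40; sequel of `EdgePencilTerminalSlope`).
Notation: `W_n^{(e)} = sixTetra F n e`, `χ(δ) = omegaSix F δ`, `ψ = ω(2,1,2) = χ(0)`, `T = ω(K₄) = χ(1)`,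
`σ = tetraSigma` (g39: leaf ⟺ `σ = 0`; no slope cap `s > 0` is a cut).

§1 THE OBJECT. The tree has no 4-party asymptotic spectrum, so we type the footprint a spectral point
leaves on the pencil: a **lower reading** (`PencilReading`) is a table `val n e ≥ 0` that is SUB-RANK,
SUPER-MULTIPLICATIVE along `W_{nm}^{(ef)} ≅ W_n^{(e)} ⊠ W_m^{(f)}` and MONOTONE in the bond. Every point
of Strassen's asymptotic spectrum of 4-tensors induces one, and so does the flattening rank of any
bipartition of the parties (§4: the cut `{0,1}|{2,3}`); no additivity or normalisation is assumed.
§2 THE LAW (every field): `val n e ≤ n^{χ(δ)}` for `1 ≤ e ≤ n^δ` (`val_le_rpow_omegaSix`); a reading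
growing like `n^γ` along `e(n) ≤ n^δ` CERTIFIES `γ ≤ χ(δ)` — readings = lower-bound certificates.
§3 THE ONE-SIDED DUAL READING (critic r1 on g39, by name): a `K₄`-MAXIMAL reading of EDGE-`01`
CHARGE `≤ β` gives `β ∈ slopeCaps`, hence `σ(K₄) ≤ β` (`tetraSigma_le_charge_of_maximal`); charge `0`
gives the leaf (`tetraExcessZero_of_maximal_of_blind`). THE SCREEN for R39.3 («one maximal point
with `β₀₁ < T/6`»): a maximal reading pins `T` (`omegaTetra_le_of_maximal`, `growth_le_omegaTetra`),
so using one requires knowing `T` exactly; at `T = 4` the flattening is already maximal and blind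
(`flatReading_maximal_iff` ⟺ `TetraFlat`; `excessZero_of_tetraFlat'` recovers the tree's
`excessZero_of_tetraFlat` through the reading), and growth `> 4` refutes `ω(ℂ) = 2`
(`not_matrixMultiplication_of_growth_gt_four`). So a ONE-POINT dual argument on the leaf is a proof
of `TetraFlat` or a disproof of the summit; short of maximality it is a slope cap, never a cut (g39).
The ALL-POINTS statement (every reading has growth `≤ ψ` on `T(K₄)`) is the leaf itself by Strassen
duality — recorded, not typed. §5 THE FLOOR THRESHOLD (critic r4): with `TetraPlusTwo`, a rung at
`a` and a cap `s` are NEWS (`ω < 2.371552`) once `(1 − a)·s < 0.208 · 0.371552`, unconditionally on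
`α` (`omega_lt_of_slopeCap_floor`); a maximal reading is graded as the pair `(a, β)`.

References: Strassen 1988, §1 (asymptotic spectrum, `R̃ = max` over spectral points) [Strassen1988];
Christandl–Vrana–Zuiddam 2023, §2 (spectral points of `k`-tensors) [ChristandlVranaZuiddam2023];
Christandl–Vrana–Zuiddam, arXiv:1609.07476, §1.1–§1.3 (graph tensors, flattenings)
[ChristandlVranaZuiddam2016]; Bläser 2013, Lemma 7.1 (2) [Blaser2013]; Coppersmith 1982, Thm. 1
[Coppersmith1982]; Vassilevska Williams–Xu–Xu–Zhou 2024, Thm. 1.2 [VassilevskaWilliamsXuXuZhou2024].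
Sorry-free; no new axiom, no instance, no notation; one structure (`PencilReading`), one value (`flatReading`).
-/

noncomputable section
set_option linter.dupNamespace false

open Filter Asymptotics Topology
open Literature.Computability.AlgebraicComplexity
open Summit.MatrixMultiplication.MatrixMultiplication.Theorems.TetrahedronTensor
open Summit.MatrixMultiplication.MatrixMultiplication.Theses.TetrahedronCarving

namespace Summit.MatrixMultiplication.MatrixMultiplication.Theorems.EdgePencil

/-! ## §0 Two exponent-comparison lemmas -/

/-- If `x^k ≤ C·y^k` for all large `k` and `0 < y`, then `x ≤ y` (`k`-th roots). [folklore] -/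
theorem le_of_pow_le_mul_pow_eventually {x y C : ℝ} (hy : 0 < y)
    (h : ∀ᶠ k : ℕ in atTop, x ^ k ≤ C * y ^ k) : x ≤ y := by
  by_contra hxy
  rw [not_le] at hxy
  have hq : 1 < x / y := (one_lt_div hy).2 hxy
  have hlim : Tendsto (fun k : ℕ => (x / y) ^ k) atTop atTop := tendsto_pow_atTop_atTop_of_one_lt hq
  have hev : ∀ᶠ k : ℕ in atTop, (x / y) ^ k ≤ C := by
    filter_upwards [h] with k hk
    rw [div_pow, div_le_iff₀ (pow_pos hy k)]
    exact hk
  obtain ⟨k, hk₁, hk₂⟩ := (hev.and (hlim.eventually_gt_atTop C)).exists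
  exact absurd hk₁ (not_le.2 hk₂)

/-- Exponent comparison: `n^a ≤ C·n^b` for all large `n : ℕ` forces `a ≤ b`. [folklore] -/
theorem rpow_exponent_le_of_eventually {a b C : ℝ}
    (h : ∀ᶠ n : ℕ in atTop, (n : ℝ) ^ a ≤ C * (n : ℝ) ^ b) : a ≤ b := by
  by_contra hab
  rw [not_le] at hab
  have hev : ∀ᶠ n : ℕ in atTop, (n : ℝ) ^ (a - b) ≤ C := by
    filter_upwards [h, eventually_gt_atTop 0] with n hn hn0
    have hn0' : (0 : ℝ) < n := Nat.cast_pos.2 hn0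
    rw [Real.rpow_sub hn0', div_le_iff₀ (Real.rpow_pos_of_pos hn0' _)]
    exact hn
  have hlim : Tendsto (fun n : ℕ => (n : ℝ) ^ (a - b)) atTop atTop :=
    (tendsto_rpow_atTop (by linarith)).comp tendsto_natCast_atTop_atTop
  obtain ⟨n, hn₁, hn₂⟩ := (hev.and (hlim.eventually_gt_atTop C)).exists
  exact absurd hn₁ (not_le.2 hn₂)

/-! ## §1 Lower readings of the pencil -/

/-- **A lower reading of the sixth-edge pencil** `n, e ↦ W_n^{(e)} = sixTetra F n e`: a non-negative
table that is SUB-RANK, SUPER-MULTIPLICATIVE along `W_{nm}^{(ef)} ≅ W_n^{(e)} ⊠ W_m^{(f)}` (`e ≤ n`,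
`f ≤ m`) and MONOTONE in the bond `e`. Every universal spectral point `F` of 4-tensors induces one
(`val n e = F(W_n^{(e)})`: `F ≤ R`; `F` multiplicative and invariant under the leg relabelling of
`sixKron_pullback_apply`; `F` restriction-monotone along `sixTetra_eq_legMul_sixTetra`), and so does
the flattening rank of any bipartition of the parties (§4). [cite: ChristandlVranaZuiddam2023, §2] -/
structure PencilReading (F : Type) [Field F] where
  /-- the value read on `W_n^{(e)} = sixTetra F n e` -/
  val : ℕ → ℕ → ℝ
  /-- values are non-negative -/
  nonneg : ∀ n e : ℕ, 0 ≤ val n e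
  /-- sub-rank: the reading never exceeds the tensor rank of `W_n^{(e)}` (`e ≥ 1`) -/
  le_rank : ∀ n e : ℕ, 1 ≤ e → val n e ≤ (tensorRankD (sixTetra F n e) : ℝ)
  /-- super-multiplicative along `W_{nm}^{(ef)} ≅ W_n^{(e)} ⊠ W_m^{(f)}` (`e ≤ n`, `f ≤ m`) -/
  supermul : ∀ n m e f : ℕ, e ≤ n → f ≤ m → val n e * val m f ≤ val (n * m) (e * f)
  /-- monotone in the sixth bond -/
  mono : ∀ n e e' : ℕ, e ≤ e' → val n e ≤ val n e'

namespace PencilReading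

variable {F : Type} [Field F]

/-- Iterated super-multiplicativity: `(val n e)^{k+1} ≤ val (n^{k+1}) (e^{k+1})` for `e ≤ n`. -/
theorem pow_succ_le (R : PencilReading F) {n e : ℕ} (he : e ≤ n) (k : ℕ) :
    R.val n e ^ (k + 1) ≤ R.val (n ^ (k + 1)) (e ^ (k + 1)) := by
  induction k with
  | zero => simp
  | succ k ih =>
    have hek : e ^ (k + 1) ≤ n ^ (k + 1) := Nat.pow_le_pow_left he _
    calc R.val n e ^ (k + 1 + 1) = R.val n e ^ (k + 1) * R.val n e := pow_succ _ _
      _ ≤ R.val (n ^ (k + 1)) (e ^ (k + 1)) * R.val n e :=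
          mul_le_mul_of_nonneg_right ih (R.nonneg n e)
      _ ≤ R.val (n ^ (k + 1) * n) (e ^ (k + 1) * e) := R.supermul _ _ _ _ hek he
      _ = R.val (n ^ (k + 1 + 1)) (e ^ (k + 1 + 1)) := by rw [← pow_succ, ← pow_succ]

/-- At level `n = 1` every reading is at most `1` (`R₄(W_1^{(e)}) ≤ R₄(T(K₄)_1) ≤ 1`). -/
theorem val_one_le (R : PencilReading F) {e : ℕ} (he : 1 ≤ e) : R.val 1 e ≤ 1 := by
  have h1 := R.le_rank 1 e he
  have h2 : tensorRankD (sixTetra F 1 e) ≤ 1 :=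
    (tensorRankD_sixTetra_le_tetra (F := F) 1 e).trans (by simpa using tensorRankD_tetra_le (F := F) 1)
  have h2' : (tensorRankD (sixTetra F 1 e) : ℝ) ≤ 1 := by exact_mod_cast h2
  exact h1.trans h2'

/-! ## §2 The reading law `val n e ≤ n^{χ(δ)}` -/

/-- A reading is dominated by every ADMISSIBLE exponent `β` of the ladder at `δ` (`1 ≤ e ≤ n^δ`,
`δ ≤ 1`): the powers `W_{n^k}^{(e^k)}` sit below `W_{n^k}^{(⌈n^{kδ}⌉)}`; take `k`-th roots.
[cite: Strassen1988, §1] -/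
theorem val_le_rpow_of_mem_sixAdmissibleExponents (R : PencilReading F) {n e : ℕ} (hn : 1 ≤ n)
    (he : 1 ≤ e) {δ : ℝ} (hδ1 : δ ≤ 1) (heδ : (e : ℝ) ≤ (n : ℝ) ^ δ) {β : ℝ}
    (hβ : β ∈ sixAdmissibleExponents F δ) : R.val n e ≤ (n : ℝ) ^ β := by
  have hn1 : (1 : ℝ) ≤ n := by exact_mod_cast hn
  have hn0 : (0 : ℝ) ≤ n := by positivity
  have hen : e ≤ n := by
    have : (e : ℝ) ≤ (n : ℝ) ^ (1 : ℝ) := heδ.trans (Real.rpow_le_rpow_of_exponent_le hn1 hδ1)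
    rw [Real.rpow_one] at this
    exact_mod_cast this
  rcases hn.eq_or_lt with h1 | hn2
  · subst h1
    simpa using R.val_one_le he
  · obtain ⟨C, hC⟩ := isBigO_iff.1 hβ
    have hsub : Tendsto (fun k : ℕ => n ^ k) atTop atTop := tendsto_pow_atTop_atTop_of_one_lt hn2
    have hy : (0 : ℝ) < (n : ℝ) ^ β := Real.rpow_pos_of_pos (by linarith) β
    have hev : ∀ᶠ k : ℕ in atTop, R.val n e ^ k ≤ C * ((n : ℝ) ^ β) ^ k := by
      filter_upwards [hsub.eventually hC, eventually_ge_atTop 1] with k hk hk1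
      obtain ⟨k, rfl⟩ : ∃ j, k = j + 1 := ⟨k - 1, by omega⟩
      rw [Real.norm_of_nonneg (Nat.cast_nonneg _),
        Real.norm_of_nonneg (Real.rpow_nonneg (Nat.cast_nonneg _) _)] at hk
      have hpow : (n : ℝ) ^ (k + 1) = ((n ^ (k + 1) : ℕ) : ℝ) := by push_cast; ring
      have hek : e ^ (k + 1) ≤ rectDim (n ^ (k + 1)) δ := by
        have h1 : ((e ^ (k + 1) : ℕ) : ℝ) ≤ ((n : ℝ) ^ δ) ^ (k + 1) := by
          push_cast
          exact pow_le_pow_left₀ (Nat.cast_nonneg e) heδ _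
        have h2 : ((n : ℝ) ^ δ) ^ (k + 1) = (((n ^ (k + 1) : ℕ) : ℝ)) ^ δ := by
          rw [← hpow, ← Real.rpow_mul_natCast hn0, mul_comm, Real.rpow_natCast_mul hn0]
        have h3 : (((n ^ (k + 1) : ℕ) : ℝ)) ^ δ ≤ (rectDim (n ^ (k + 1)) δ : ℝ) := Nat.le_ceil _
        exact_mod_cast h1.trans (h2.le.trans h3)
      have hrd : 1 ≤ rectDim (n ^ (k + 1)) δ := one_le_rectDim (Nat.one_le_pow _ _ hn) δ
      calc R.val n e ^ (k + 1) ≤ R.val (n ^ (k + 1)) (e ^ (k + 1)) := R.pow_succ_le hen k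
        _ ≤ R.val (n ^ (k + 1)) (rectDim (n ^ (k + 1)) δ) := R.mono _ _ _ hek
        _ ≤ (tensorRankD (sixTetra F (n ^ (k + 1)) (rectDim (n ^ (k + 1)) δ)) : ℝ) :=
            R.le_rank _ _ hrd
        _ ≤ C * (((n ^ (k + 1) : ℕ) : ℝ)) ^ β := hk
        _ = C * ((n : ℝ) ^ β) ^ (k + 1) := by
            rw [← hpow, ← Real.rpow_natCast_mul hn0, mul_comm ((k + 1 : ℕ) : ℝ) β,
              Real.rpow_mul_natCast hn0]
    exact le_of_pow_le_mul_pow_eventually hy hev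

/-- **READING LAW.** `val n e ≤ n^{χ(δ)}` whenever `1 ≤ e ≤ n^δ`, `0 ≤ δ ≤ 1`, `n ≥ 1`: a lower reading
never beats the exponent of the ladder (right-continuity of `β ↦ n^β` over the admissible set).
[cite: Strassen1988, §1 (R̃ = max over the spectrum: the easy inequality)] -/
theorem val_le_rpow_omegaSix (R : PencilReading F) {n e : ℕ} (hn : 1 ≤ n) (he : 1 ≤ e) {δ : ℝ}
    (hδ1 : δ ≤ 1) (heδ : (e : ℝ) ≤ (n : ℝ) ^ δ) : R.val n e ≤ (n : ℝ) ^ omegaSix F δ := by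
  have hn1 : (1 : ℝ) ≤ n := by exact_mod_cast hn
  have hn0 : (n : ℝ) ≠ 0 := by positivity
  have hgt : ∀ β : ℝ, omegaSix F δ < β → R.val n e ≤ (n : ℝ) ^ β := by
    intro β hβ
    obtain ⟨γ, hγ, hγβ⟩ := (csInf_lt_iff (sixAdmissibleExponents_bddBelow F δ)
      (sixAdmissibleExponents_nonempty F δ)).1 hβ
    exact (R.val_le_rpow_of_mem_sixAdmissibleExponents hn he hδ1 heδ hγ).trans
      (Real.rpow_le_rpow_of_exponent_le hn1 hγβ.le)
  have htend : Tendsto (fun β : ℝ => (n : ℝ) ^ β) (𝓝[>] omegaSix F δ)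
      (𝓝 ((n : ℝ) ^ omegaSix F δ)) :=
    ((Real.continuousAt_const_rpow hn0).tendsto).mono_left nhdsWithin_le_nhds
  exact ge_of_tendsto htend (eventually_nhdsWithin_of_forall fun β hβ => hgt β hβ)

/-- `val n n ≤ n^{ω(K₄)}` (`δ = 1`). [cite: ChristandlVranaZuiddam2016, Def. 1.1.13] -/
theorem val_le_rpow_omegaTetra (R : PencilReading F) {n : ℕ} (hn : 1 ≤ n) :
    R.val n n ≤ (n : ℝ) ^ omegaTetra F := by
  have h := R.val_le_rpow_omegaSix hn hn (δ := 1) le_rfl (by rw [Real.rpow_one])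
  rwa [omegaSix_one] at h

/-- `val n 1 ≤ n^{ω(2,1,2)}` (`δ = 0`: the diamond end). [cite: ChristandlVranaZuiddam2016, Def. 1.1.13] -/
theorem val_le_rpow_omegaRect (R : PencilReading F) {n : ℕ} (hn : 1 ≤ n) :
    R.val n 1 ≤ (n : ℝ) ^ omegaRect F 2 1 2 := by
  have h := R.val_le_rpow_omegaSix hn le_rfl (δ := 0) zero_le_one (by rw [Real.rpow_zero]; simp)
  rwa [omegaSix_zero] at h

/-- **Readings are lower-bound certificates on the ladder**: a reading growing like `n^γ` along bonds
`1 ≤ e(n) ≤ n^δ` certifies `γ ≤ χ(δ)`. [cite: Strassen1988, §1] -/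
theorem le_omegaSix_of_growth (R : PencilReading F) {δ γ : ℝ} (hδ1 : δ ≤ 1) (e : ℕ → ℕ)
    (he : ∀ᶠ n : ℕ in atTop, 1 ≤ e n ∧ ((e n : ℕ) : ℝ) ≤ (n : ℝ) ^ δ)
    (hγ : ∀ᶠ n : ℕ in atTop, (n : ℝ) ^ γ ≤ R.val n (e n)) : γ ≤ omegaSix F δ := by
  refine rpow_exponent_le_of_eventually (C := 1) ?_
  filter_upwards [he, hγ, eventually_ge_atTop 1] with n hn hnγ hn1
  rw [one_mul]
  exact hnγ.trans (R.val_le_rpow_omegaSix hn1 hn.1 hδ1 hn.2)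

/-- **A reading's growth on `T(K₄)_n` never exceeds `ω(K₄)`.** [cite: ChristandlVranaZuiddam2016, §1.2] -/
theorem growth_le_omegaTetra (R : PencilReading F) {γ : ℝ}
    (hγ : ∀ᶠ n : ℕ in atTop, (n : ℝ) ^ γ ≤ R.val n n) : γ ≤ omegaTetra F := by
  refine rpow_exponent_le_of_eventually (C := 1) ?_
  filter_upwards [hγ, eventually_ge_atTop 1] with n hnγ hn1
  rw [one_mul]
  exact hnγ.trans (R.val_le_rpow_omegaTetra hn1)

/-! ## §3 The one-sided dual reading: maximal readings cap the terminal slope -/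

/-- **THE ONE-SIDED DUAL READING (critic r1, typed).** A `K₄`-MAXIMAL reading (`n^{ω(K₄)−ε} ≤ val n n`
eventually, every `ε > 0`) of EDGE-`01` CHARGE `≤ β` (`val n n ≤ val n e · (n/e)^β`, `1 ≤ e ≤ n`)
yields the slope cap `β`: `ω(K₄) ≤ χ(δ) + β(1 − δ)` on `[0,1]` (read at `e = ⌊n^δ⌋`). For a spectral
point `β` is its `EPR₀₁`-rate, maximality = it attains `ω(K₄)`. [cite: Strassen1988, §1] -/
theorem mem_slopeCaps_of_maximal_of_charge (R : PencilReading F) {β : ℝ} (hβ : 0 ≤ β)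
    (hmax : ∀ ε : ℝ, 0 < ε → ∀ᶠ n : ℕ in atTop, (n : ℝ) ^ (omegaTetra F - ε) ≤ R.val n n)
    (hch : ∀ n e : ℕ, 1 ≤ e → e ≤ n → R.val n n ≤ R.val n e * ((n : ℝ) / e) ^ β) :
    β ∈ slopeCaps F := by
  refine ⟨hβ, fun δ hδ0 hδ1 => ?_⟩
  have key : ∀ ε : ℝ, 0 < ε → omegaTetra F - ε ≤ omegaSix F δ + β * (1 - δ) := by
    intro ε hε
    have hev : ∀ᶠ n : ℕ in atTop, (n : ℝ) ^ (omegaTetra F - ε) ≤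
        (2 : ℝ) ^ β * (n : ℝ) ^ (omegaSix F δ + β * (1 - δ)) := by
      filter_upwards [hmax ε hε, eventually_ge_atTop 1] with n hn hn1
      have hn1' : (1 : ℝ) ≤ n := by exact_mod_cast hn1
      have hnpos : (0 : ℝ) < n := by linarith
      have hnδ1 : (1 : ℝ) ≤ (n : ℝ) ^ δ := Real.one_le_rpow hn1' hδ0
      set e : ℕ := ⌊(n : ℝ) ^ δ⌋₊ with he_def
      have he1 : 1 ≤ e := Nat.floor_pos.2 hnδ1
      have he1' : (1 : ℝ) ≤ e := by exact_mod_cast he1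
      have heδ : (e : ℝ) ≤ (n : ℝ) ^ δ := Nat.floor_le (by positivity)
      have hen : e ≤ n := by
        have : (e : ℝ) ≤ (n : ℝ) ^ (1 : ℝ) := heδ.trans (Real.rpow_le_rpow_of_exponent_le hn1' hδ1)
        rw [Real.rpow_one] at this
        exact_mod_cast this
      have he2 : (n : ℝ) ^ δ ≤ 2 * e := by
        have := Nat.lt_floor_add_one ((n : ℝ) ^ δ)
        rw [← he_def] at this
        linarith
      have hq : (n : ℝ) / e ≤ 2 * (n : ℝ) ^ (1 - δ) := by
        rw [div_le_iff₀ (by positivity : (0 : ℝ) < e)]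
        calc (n : ℝ) = (n : ℝ) ^ (1 - δ) * (n : ℝ) ^ δ := by rw [← Real.rpow_add hnpos]; norm_num
          _ ≤ (n : ℝ) ^ (1 - δ) * (2 * e) := mul_le_mul_of_nonneg_left he2 (Real.rpow_nonneg hnpos.le _)
          _ = 2 * (n : ℝ) ^ (1 - δ) * e := by ring
      have hqβ : ((n : ℝ) / e) ^ β ≤ (2 : ℝ) ^ β * (n : ℝ) ^ (β * (1 - δ)) := by
        calc ((n : ℝ) / e) ^ β ≤ (2 * (n : ℝ) ^ (1 - δ)) ^ β :=
              Real.rpow_le_rpow (by positivity) hq hβ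
          _ = (2 : ℝ) ^ β * ((n : ℝ) ^ (1 - δ)) ^ β :=
              Real.mul_rpow (by norm_num) (Real.rpow_nonneg hnpos.le _)
          _ = (2 : ℝ) ^ β * (n : ℝ) ^ (β * (1 - δ)) := by rw [← Real.rpow_mul hnpos.le, mul_comm (1 - δ) β]
      calc (n : ℝ) ^ (omegaTetra F - ε) ≤ R.val n n := hn
        _ ≤ R.val n e * ((n : ℝ) / e) ^ β := hch n e he1 hen
        _ ≤ (n : ℝ) ^ omegaSix F δ * ((2 : ℝ) ^ β * (n : ℝ) ^ (β * (1 - δ))) :=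
            mul_le_mul (R.val_le_rpow_omegaSix hn1 he1 hδ1 heδ) hqβ
              (Real.rpow_nonneg (by positivity) _) (Real.rpow_nonneg hnpos.le _)
        _ = (2 : ℝ) ^ β * (n : ℝ) ^ (omegaSix F δ + β * (1 - δ)) := by
            rw [Real.rpow_add hnpos]; ring
    exact rpow_exponent_le_of_eventually hev
  by_contra hlt
  rw [not_le] at hlt
  have := key ((omegaTetra F - (omegaSix F δ + β * (1 - δ))) / 2) (by linarith)
  linarith

/-- **`σ(K₄) ≤ β₀₁`**: the terminal slope is at most the edge-`01` charge of any `K₄`-maximal reading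
(the inequality half of NODE-g39 T39.4; critic r1 by name). [cite: Strassen1988, §1] -/
theorem tetraSigma_le_charge_of_maximal (R : PencilReading F) {β : ℝ} (hβ : 0 ≤ β)
    (hmax : ∀ ε : ℝ, 0 < ε → ∀ᶠ n : ℕ in atTop, (n : ℝ) ^ (omegaTetra F - ε) ≤ R.val n n)
    (hch : ∀ n e : ℕ, 1 ≤ e → e ≤ n → R.val n n ≤ R.val n e * ((n : ℝ) / e) ^ β) :
    tetraSigma F ≤ β :=
  csInf_le (slopeCaps_bddBelow F) (R.mem_slopeCaps_of_maximal_of_charge hβ hmax hch)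

/-- **A maximal reading BLIND to the sixth edge (charge `0`) gives the leaf** `ω(K₄) ≤ ω(2,1,2)`.
[cite: Strassen1988, §1] -/
theorem excessZero_of_maximal_of_blind (R : PencilReading F)
    (hmax : ∀ ε : ℝ, 0 < ε → ∀ᶠ n : ℕ in atTop, (n : ℝ) ^ (omegaTetra F - ε) ≤ R.val n n)
    (hblind : ∀ n e : ℕ, 1 ≤ e → e ≤ n → R.val n n ≤ R.val n e) :
    omegaTetra F ≤ omegaRect F 2 1 2 := by
  have h := R.mem_slopeCaps_of_maximal_of_charge (β := 0) le_rfl hmax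
    (fun n e he hen => by simpa [Real.rpow_zero] using hblind n e he hen)
  have h0 := h.2 0 le_rfl zero_le_one
  rw [omegaSix_zero] at h0
  linarith

/-- **A maximal reading pins `ω(K₄)`**: if it is `O(n^g)` on `T(K₄)_n` then `ω(K₄) ≤ g` — to USE a
maximal point one must know `ω(K₄)` exactly (`≥`: `growth_le_omegaTetra`). [cite: Strassen1988, §1] -/
theorem omegaTetra_le_of_maximal (R : PencilReading F) {g C : ℝ}
    (hmax : ∀ ε : ℝ, 0 < ε → ∀ᶠ n : ℕ in atTop, (n : ℝ) ^ (omegaTetra F - ε) ≤ R.val n n)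
    (hg : ∀ᶠ n : ℕ in atTop, R.val n n ≤ C * (n : ℝ) ^ g) : omegaTetra F ≤ g := by
  have key : ∀ ε : ℝ, 0 < ε → omegaTetra F - ε ≤ g := fun ε hε =>
    rpow_exponent_le_of_eventually ((hmax ε hε).and hg |>.mono fun n hn => hn.1.trans hn.2)
  by_contra hlt
  have := key ((omegaTetra F - g) / 2) (by rw [not_le] at hlt; linarith)
  linarith

end PencilReading

/-- **R39.3 by name**: a `K₄`-maximal lower reading over `ℂ` blind to the sixth edge proves
`TetraExcessZero`; one of charge `β` gives `tetraSigma ℂ ≤ β`. [cite: Strassen1988, §1] -/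
theorem tetraExcessZero_of_maximal_of_blind (R : PencilReading ℂ)
    (hmax : ∀ ε : ℝ, 0 < ε → ∀ᶠ n : ℕ in atTop, (n : ℝ) ^ (omegaTetra ℂ - ε) ≤ R.val n n)
    (hblind : ∀ n e : ℕ, 1 ≤ e → e ≤ n → R.val n n ≤ R.val n e) : TetraExcessZero :=
  R.excessZero_of_maximal_of_blind hmax hblind

/-- **THE SCREEN, informative branch**: a reading growing faster than `n⁴` on `T(K₄)_n` (on the ladder:
`le_omegaSix_of_growth` + `not_matrixMultiplication_of_four_lt_omegaSix`) REFUTES `ω(ℂ) = 2` — a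
maximal point that is not cut-valued disproves the summit. [cite: ChristandlVranaZuiddam2016, §1.3] -/
theorem not_matrixMultiplication_of_growth_gt_four (R : PencilReading ℂ) {γ : ℝ} (hγ4 : 4 < γ)
    (hγ : ∀ᶠ n : ℕ in atTop, (n : ℝ) ^ γ ≤ R.val n n) : ¬ _root_.MatrixMultiplication :=
  fun hS => absurd ((R.growth_le_omegaTetra hγ).trans (omegaTetra_le_four_of_matrixMultiplication hS))
    (not_le.2 hγ4)

/-! ## §4 The flattening reading of the cut `{0,1}|{2,3}` -/

/-- **The `{0,1}|{2,3}` flattening reading** `val n e = n⁴` (edges `02, 03, 12, 13` cross the cut, `01`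
does not: charge `0`); `n⁴ ≤ R(⟨n², n, n²⟩) ≤ R₄(D_n) ≤ R₄(W_n^{(e)})`. [cite: Blaser2013, Lemma 7.1 (2)] -/
def flatReading (F : Type) [Field F] : PencilReading F where
  val n _ := (n : ℝ) ^ (4 : ℕ)
  nonneg n e := by positivity
  le_rank n e he := by
    rcases Nat.eq_zero_or_pos n with rfl | hn
    · simp
    · haveI : NeZero n := ⟨hn.ne'⟩
      have h1 : n * n * (n * n) ≤ tensorRank (matMulTensor F (n * n) n (n * n)) :=
        mul_le_tensorRank_matMulTensor F (n * n) n (n * n)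
      have h2 : tensorRank (matMulTensor F (n * n) n (n * n)) ≤ tensorRankD (pencil F n n) :=
        tensorRank_matMulTensor_le_tensorRankD_pencil hn le_rfl
      have h3 : tensorRankD (pencil F n n) ≤ tensorRankD (sixTetra F n e) :=
        tensorRankD_pencil_le_sixTetra he
      have h : n ^ 4 ≤ tensorRankD (sixTetra F n e) := by
        calc n ^ 4 = n * n * (n * n) := by ring
          _ ≤ tensorRankD (sixTetra F n e) := h1.trans (h2.trans h3)
      exact_mod_cast h
  supermul n m e f _ _ := by push_cast; rw [mul_pow]
  mono n e e' _ := le_rfl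

/-- The flattening reading is blind to the sixth edge (charge `0`). [cite: ChristandlVranaZuiddam2016, §1.2] -/
theorem flatReading_blind (F : Type) [Field F] (n e : ℕ) :
    (flatReading F).val n n ≤ (flatReading F).val n e := le_rfl

/-- **The flattening reading is `K₄`-maximal iff `ω(K₄) ≤ 4`** (`TetraFlat` over `ℂ`): at `T = 4` the
requested maximal blind point exists and is the flattening. [cite: ChristandlVranaZuiddam2016, §1.2] -/
theorem flatReading_maximal_iff (F : Type) [Field F] :
    (∀ ε : ℝ, 0 < ε → ∀ᶠ n : ℕ in atTop, (n : ℝ) ^ (omegaTetra F - ε) ≤ (flatReading F).val n n) ↔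
      omegaTetra F ≤ 4 := by
  constructor
  · intro h
    refine (flatReading F).omegaTetra_le_of_maximal (C := 1) h ?_
    filter_upwards with n
    show (n : ℝ) ^ (4 : ℕ) ≤ 1 * (n : ℝ) ^ (4 : ℝ)
    rw [one_mul, ← Real.rpow_natCast]
    norm_num
  · intro hT ε hε
    filter_upwards [eventually_ge_atTop 1] with n hn
    have hn1 : (1 : ℝ) ≤ n := by exact_mod_cast hn
    show (n : ℝ) ^ (omegaTetra F - ε) ≤ (n : ℝ) ^ (4 : ℕ)
    rw [← Real.rpow_natCast]
    exact Real.rpow_le_rpow_of_exponent_le hn1 (by push_cast; linarith)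

/-- **The tree's `excessZero_of_tetraFlat`, through the reading**: `ω(K₄) ≤ 4 ⟹ ω(K₄) ≤ ω(2,1,2)` (every
field; the flattening is then a maximal blind point). [cite: ChristandlVranaZuiddam2016, §1.2] -/
theorem excessZero_of_tetraFlat' (F : Type) [Field F] (hT : omegaTetra F ≤ 4) :
    omegaTetra F ≤ omegaRect F 2 1 2 :=
  (flatReading F).excessZero_of_maximal_of_blind ((flatReading_maximal_iff F).2 hT)
    fun n e _ _ => flatReading_blind F n e

/-! ## §5 The unconditional news threshold (critic r4) -/

/-- **NEWS THRESHOLD, floor form (critic r4; unconditional on `α`)**: with `TetraPlusTwo`, a rung at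
`a ∈ [0,1]` and a cap `σ(K₄) ≤ s` beat the printed `ω < 2.371552` once `(1 − a)·s < 0.208·0.371552`
(`= 0.0773…`; floor `α > 0.1722`). [cite: Coppersmith1982, Thm. 1] [cite: VassilevskaWilliamsXuXuZhou2024, Thm. 1.2] -/
theorem omega_lt_of_slopeCap_floor (hB : TetraPlusTwo) {a s : ℝ} (ha0 : 0 ≤ a) (ha1 : a ≤ 1)
    (hr : omegaSix ℂ a ≤ omegaRect ℂ 2 1 2) (hs : tetraSigma ℂ ≤ s)
    (hnews : (1 - a) * s < 0.208 * 0.371552) : omega ℂ < 2.371552 := by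
  have h := slopePrice_floor ℂ ha0 ha1 hr hs (residual_of_tetraPlusTwo hB)
  linarith

/-- **A maximal reading is graded as the pair `(a, β)`**: with `TetraPlusTwo`, a rung at `a` and a maximal
reading of charge `β` are news once `(1 − a)β < 0.208·0.371552`. [cite: VassilevskaWilliamsXuXuZhou2024, Thm. 1.2] -/
theorem omega_lt_of_maximalReading (hB : TetraPlusTwo) (R : PencilReading ℂ) {a β : ℝ}
    (ha0 : 0 ≤ a) (ha1 : a ≤ 1) (hr : omegaSix ℂ a ≤ omegaRect ℂ 2 1 2) (hβ : 0 ≤ β)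
    (hmax : ∀ ε : ℝ, 0 < ε → ∀ᶠ n : ℕ in atTop, (n : ℝ) ^ (omegaTetra ℂ - ε) ≤ R.val n n)
    (hch : ∀ n e : ℕ, 1 ≤ e → e ≤ n → R.val n n ≤ R.val n e * ((n : ℝ) / e) ^ β)
    (hnews : (1 - a) * β < 0.208 * 0.371552) : omega ℂ < 2.371552 :=
  omega_lt_of_slopeCap_floor hB ha0 ha1 hr (R.tetraSigma_le_charge_of_maximal hβ hmax hch) hnews

end Summit.MatrixMultiplication.MatrixMultiplication.Theorems.EdgePencil
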